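import Literature.IUT.HodgeTheaters.GenuineFKitOfBadLocal
import Literature.IUT.HodgeTheaters.ConventionsCatIsomorphismGroup
import Literature.AlgebraicGeometry.Frobenioids.ArithmeticRealificationInstance
import Literature.AlgebraicGeometry.Frobenioids.BaseSectionsOfObjectsCor57NonVacuity
import HarnessLib

/-!
# Hub object (m4) INHABITED BY NAME: the realified global side of `InitialThetaData.MergeInputs` from THE realified
# arithmetic Frobenioid `𝒞⊩_mod` of abc-iut-L1 ([FrdI] Ex. 6.3 / Thm. 6.4 (i)), read in the one-object kind of [IUTchI] §0

S. Mochizuki, *Inter-universal Teichmüller theory I*, kurims manuscript (May 2020), Example 3.5 (i) p. 84 («the realification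
`𝒞⊩_mod` of the Frobenioid of [FrdI], Example 6.3»), Definition 5.2 (iv) (a) p. 134 («`‡𝒞^⊩` is a category … isomorphic to the category
`𝒞⊩_mod`»), §0 p. 33 («an isomorphism class of equivalences between two categories … an isomorphism between the two categories»)
([IUTchI] Ex 3.5 (i) p.84) [claim: Mochizuki2012, status: disputed] (D-0012 claim key, series status DISPUTED — a CONSTRUCTION by name over
abc-iut-L1's landed [FrdI] files; nothing of the series is asserted; no side is taken on [IUTchIII] Cor. 3.12).
S. Mochizuki, *The geometry of Frobenioids I*, Kyushu J. Math. **62** (2008), Ex. 6.3 p. 113, Prop. 5.3 p. 103, Thm. 6.4 (i) p. 114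
[cite: MochizukiFrdI2008, Thm. 6.4 (i) p.114] — abc-iut-L1-lead R173 (2026-08-27T04:33:06Z): «the genuine `𝒞⊩_mod` EXISTS in tree,
hypothesis-free, universe 0: `PreFrobenioid.rlf (ModelFrobenioid.toElem (arithDivisorFunctor L L) (unitsFunctor L L) (divNatTrans L L))
(arith_objectwise_isPerfFactorial L L)` … packaged with Pic/δ as `arithRealification` … instantiate I.m4 BY NAME from these».

WHAT IS BUILT (L5 BASE-MERGE RACE, racer C sequel; non-vacuity of the `m4` field of the merge record p496697):
* `rlfArithCat L` — THE realified arithmetic Frobenioid `𝒞_{L/L}^rlf` of a number field `L` (abbreviation of L1's term, hypothesis-free);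
* `InitialThetaData.RealifiedGlobalSide.ofNumberField L` — the record ⟨`Glob`, `gModel`⟩ with `Glob := SingleObj (CatAut (rlfArithCat L))`,
  abc-iut-L5-t4's one-object KIND of §0-isomorphs of a category (`ConventionsCatIsomorphismGroup`, the H2 design of record for kinds of
  REAL Frobenioids), and `gModel := ⋆` = `𝒞^rlf` itself; `…ofModuli E := ofNumberField F_mod` at the field of moduli of the initial
  Θ-data; `nonempty_realifiedGlobalSide` (the hub's (m4) slot is INHABITED).
HONEST LABEL: the record carries the CATEGORY `‡𝒞^⊩ ≅ 𝒞⊩_mod` up to §0-isomorphism; the bijection `Prime(‡𝒞^⊩) ⥲ 𝕍` and the isomorphisms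
`ρ_v` of Def. 5.2 (iv) (b)(c)(e) are not fields of `RealifiedGlobalSide` (they are abc-iut-L5-t2's `PhiMod`/`EffArithDivisor` material,
R173 (B)); no instance, no notation, no `sorry`; typed ≠ inhabited ≠ proved; nothing here asserts abc proved or refuted.
-/

noncomputable section

namespace Literature.IUT.HodgeTheaters

open CategoryTheory Literature.AlgebraicGeometry.Frobenioids

/-- **`𝒞_{L/L}^rlf`, THE realified arithmetic Frobenioid of a number field `L`** ([FrdI] Ex. 6.3 arithmetic Frobenioid of `L` over
`𝓑(Gal(L/L))⁰`, realified by Prop. 5.3 at the perf-factorial divisor monoid — abc-iut-L1's term, hypothesis-free).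
[cite: MochizukiFrdI2008, Thm. 6.4 (i) p.114] -/
abbrev rlfArithCat (L : Type) [Field L] [NumberField L] : Type :=
  PreFrobenioid.rlf (ModelFrobenioid.toElem (arithDivisorFunctor L L) (unitsFunctor L L) (divNatTrans L L))
    (arith_objectwise_isPerfFactorial L L)

namespace InitialThetaData

/-- **Hub object (m4) from a number field `L`**: `Glob :=` the one-object kind `SingleObj (CatAut 𝒞_{L/L}^rlf)` of §0-isomorphs of THE
realified arithmetic Frobenioid, `gModel := ⋆` (= `𝒞^rlf` itself). ([IUTchI] Ex 3.5 (i) p.84) [claim: Mochizuki2012, status: disputed] -/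
def RealifiedGlobalSide.ofNumberField (L : Type) [Field L] [NumberField L] : RealifiedGlobalSide where
  Glob := SingleObj (CatAut (rlfArithCat L))
  gModel := SingleObj.star _

/-- Its global category is the one-object kind of `𝒞_{L/L}^rlf`. ([IUTchI] Ex 3.5 (i) p.84) [claim: Mochizuki2012, status: disputed] -/
theorem RealifiedGlobalSide.ofNumberField_Glob (L : Type) [Field L] [NumberField L] :
    (RealifiedGlobalSide.ofNumberField L).Glob = SingleObj (CatAut (rlfArithCat L)) := rfl

variable {F K Fbar : Type} [Field F] [NumberField F] [Field K] [NumberField K] [Algebra F K]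
  [Field Fbar] [Algebra F Fbar] [Algebra K Fbar] {E : WeierstrassCurve F}
  [E.IsElliptic] {l : ℕ} {Pb : BadPlacePredicates K}

/-- **Hub object (m4) OF THE INITIAL Θ-DATA: `𝒞⊩_mod`** = the realified arithmetic Frobenioid of the field of moduli `F_mod` (Ex. 3.5 (i)),
read in its one-object kind. ([IUTchI] Ex 3.5 (i) p.84) [claim: Mochizuki2012, status: disputed] -/
def realifiedGlobalSideOfModuli (_D : InitialThetaData F K Fbar E l Pb) : RealifiedGlobalSide :=
  RealifiedGlobalSide.ofNumberField (fieldOfModuli E)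

/-- The (m4) slot of the merge record is INHABITED (by `𝒞⊩_mod`). ([IUTchI] Def 5.2 (iv) p.134) [claim: Mochizuki2012, status: disputed] -/
theorem nonempty_realifiedGlobalSide (D : InitialThetaData F K Fbar E l Pb) : Nonempty RealifiedGlobalSide :=
  ⟨D.realifiedGlobalSideOfModuli⟩

end InitialThetaData

end Literature.IUT.HodgeTheaters

end
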